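import Literature.AlgebraicGeometry.Motives.AbelianVarietyIsogenyPullbackPushforwardNatural
import Literature.AlgebraicGeometry.Modules.PullbackPushforwardTwistNaturality
import HarnessLib

/-!
# `g^*(g_*E•) ≅ ∏_{x ∈ Ker g(ℂ)} t_x^*E•` for complexes — the natural ∕ «derived» form (D♮) of the isogeny decomposition

Layer `Literature/AlgebraicGeometry/Motives`, namespaces `Literature.AlgebraicGeometry.Motives` (the statement (D♮)) and
`Literature.AlgebraicGeometry.Motives.AbelianVariety` (its proof and corollaries).
(Typing debt of cell `pub-hodge-ring2`, director-hodge g14 R14.24 ∕ R14.26 (2), seat core-D: «(ii) termwise extension to bounded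
complexes of vector bundles as a typed statement `DerivedIsogenyPullbackPushforwardDecomposition` — this decl IS core-R's input (i)»;
in support of `stmt-HodgeConjecture-26512`; research route conditional on HC_CM; not a corollary; Q11.4-sentence-2 already refuted
in dim ≥ 3.)

For an isogeny `g : A → B` of complex abelian varieties with kernel translations `t_x`, `x ∈ Ker g(ℂ)`, and a complex `E•` of
`𝒪_A`-modules, the direct and inverse images act termwise (Mathlib's `Functor.mapHomologicalComplex`; on the Hodge road these are
LITERALLY `endoPushforwardComplex A g E•` and `translationPullbackComplex A x E•`), and the canonical comparison maps
`toPi … (Eⁱ) : g^*g_*Eⁱ ⟶ ∏_x t_x^*Eⁱ` — natural in the module (`toPi_naturality`) — assemble into a morphism of complexes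
`toPiComplex … E• : g^*g_*E• ⟶ ∏_x t_x^*E•` (`Literature/AlgebraicGeometry/Modules/PullbackPushforwardTwistNaturality.lean`).

* `DerivedIsogenyPullbackPushforwardDecomposition` — **(D♮)**, the statement: for every complex isogeny `g : A → B` and every cochain
  complex `E•` of `𝒪_A`-modules with finite locally free terms, `toPiComplex (Hom.toSchemeHom g) (kerTranslation g) _ E•` is an
  isomorphism of complexes `g^*g_*E• ≅ ∏_{x ∈ Ker g(ℂ)} t_x^*E•` (Mumford, *Abelian Varieties* §7 Thm. 4 ∕ §12 Thm. 1, termwise).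
* `derivedIsogenyPullbackPushforwardDecomposition_holds` — **(D♮) HOLDS** (`isIso_toPiComplex_kerTranslation`: termwise
  `isIso_toPi_kerTranslation`, and a termwise isomorphism of complexes is an isomorphism), indeed for complexes of any shape with
  affine-localizing (e.g. quasi-coherent) terms.
* `nonempty_pullback_pushforward_complex_iso_sigma_kerTranslation` (+ `…_of_isFiniteLocallyFree`) — the COPRODUCT form
  **`g^*g_*E• ≅ ∐_{x ∈ Ker g(ℂ)} t_x^*E•` in the category of complexes** (finite biproducts), the shape consumed after `DerivedCategory.Q`
  by `Ext`-additivity (`Ext^k(g^*g_*E•, –) = ⊕_x Ext^k(t_x^*E•, –)`).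

NOT here (separate nodes of the road, NOT claimed): the adjunction `g^* ⊣ g_*` on `Ext` ∕ the derived category, exactness of `g_*`,
anything about `At`, `Tr`, `σ_q`. Nothing in this file is specific to vector bundles except the packaging of (D♮).

## References

* [MumfordAV1970] D. Mumford, *Abelian Varieties* (1970), §7 Thm. 4 (p. 72); §12 Thm. 1 (p. 111).
* [Mukai1978] S. Mukai, *Semi-homogeneous vector bundles on an abelian variety*, J. Math. Kyoto Univ. 18 (1978), §3 Prop. 3.12 (p. 249).
* [Hartshorne1977] R. Hartshorne, GTM 52, II.5 p. 110, III.1.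
-/

noncomputable section

universe u

open CategoryTheory CategoryTheory.Limits AlgebraicGeometry TopologicalSpace

namespace Literature.AlgebraicGeometry.Motives

open Literature.AlgebraicGeometry.Modules AbelianVariety

/-- **(D♮) — the natural ∕ «derived» form of the isogeny decomposition, for complexes of vector bundles**: for every isogeny
`g : A → B` of complex abelian varieties and every cochain complex `E•` of `𝒪_A`-modules whose terms are finite locally free, the
canonical termwise comparison `toPiComplex (Hom.toSchemeHom g) (kerTranslation g) _ E• : g^*(g_*E•) ⟶ ∏_{x ∈ Ker g(ℂ)} t_x^*E•`
(tuple over the kernel points of `g^*g_*E• = (t_x ≫ g)^*g_*E• ≅ t_x^*g^*g_*E• → t_x^*E•`, the product taken in the category of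
complexes) is an ISOMORPHISM — Mumford's `π^*π_*F ≅ ⊕_{x ∈ K} T_x^*F` (§7 Thm. 4, §12 Thm. 1; Mukai §3 Prop. 3.12 for vector bundles
along isogenies) applied termwise, the comparison being natural in the module. PROVED below
(`AbelianVariety.derivedIsogenyPullbackPushforwardDecomposition_holds`). [cite: MumfordAV1970, §7 Thm. 4 (p. 72) and §12 Thm. 1 (p. 111)]
[cite: Mukai1978, §3 Prop. 3.12 (p. 249)] -/
def DerivedIsogenyPullbackPushforwardDecomposition : Prop :=
  ∀ (A B : AbelianVariety ℂ) (g : A ⟶ B), IsIsogeny g →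
    ∀ (E : CochainComplex A.X.left.Modules ℤ), (∀ i, IsFiniteLocallyFree (E.X i)) →
      IsIso (toPiComplex (Hom.toSchemeHom g) (kerTranslation g) (kerTranslation_comp g) E)

namespace AbelianVariety

variable {A B : AbelianVariety ℂ} (g : A ⟶ B)

/-- **`toPiComplex : g^*(g_*E•) ⟶ ∏_x t_x^*E•` is an isomorphism** for every isogeny `g` and every complex `E•` (any shape) with
affine-localizing terms: termwise `isIso_toPi_kerTranslation`, and `isIso_toPiComplex_of_isIso_toPi`.
[cite: MumfordAV1970, §7 Thm. 4 (p. 72) and §12 Thm. 1 (p. 111)] -/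
theorem isIso_toPiComplex_kerTranslation (hg : IsIsogeny g) {ι : Type*} {c : ComplexShape ι}
    (E : HomologicalComplex A.X.left.Modules c) (hE : ∀ i, IsAffineLocalizing (E.X i)) :
    IsIso (toPiComplex (Hom.toSchemeHom g) (kerTranslation g) (kerTranslation_comp g) E) :=
  isIso_toPiComplex_of_isIso_toPi _ _ _ E fun i => isIso_toPi_kerTranslation g hg _ (hE i)

/-- **(D♮) HOLDS.** [cite: MumfordAV1970, §7 Thm. 4 (p. 72) and §12 Thm. 1 (p. 111)] [cite: Mukai1978, §3 Prop. 3.12 (p. 249)] -/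
theorem derivedIsogenyPullbackPushforwardDecomposition_holds : DerivedIsogenyPullbackPushforwardDecomposition :=
  fun _ _ g hg E hE => isIso_toPiComplex_kerTranslation g hg E fun i => by
    haveI := (hE i).isVectorBundle.1
    exact IsAffineLocalizing.of_isQuasicoherent _

/-- `DerivedIsogenyPullbackPushforwardDecomposition` — `_holds` alias of `derivedIsogenyPullbackPushforwardDecomposition_holds` above under the fact's exact name (appended
2026-08-28, D-0026 bookkeeping: the proof term is the existing theorem of this file; no statement,
definition or attribute is edited; no new named fact; the ledger's debt table listed the fact
unproved). [cite: Mukai1978, §3 Prop. 3.12 (p. 249)] -/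
theorem _root_.Literature.AlgebraicGeometry.Motives.DerivedIsogenyPullbackPushforwardDecomposition_holds :
    DerivedIsogenyPullbackPushforwardDecomposition :=
  _root_.Literature.AlgebraicGeometry.Motives.AbelianVariety.derivedIsogenyPullbackPushforwardDecomposition_holds

/-- **`g^*(g_*E•) ≅ ∐_{x ∈ Ker g(ℂ)} t_x^*E•` as complexes** (any shape, affine-localizing terms): the coproduct form of (D♮) in the
category of complexes of `𝒪_A`-modules (finite biproducts), `t_x^*E•` the termwise pull-back along the translation by `x`.
[cite: MumfordAV1970, §7 Thm. 4 (p. 72) and §12 Thm. 1 (p. 111)] -/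
theorem nonempty_pullback_pushforward_complex_iso_sigma_kerTranslation (hg : IsIsogeny g) {ι : Type*} {c : ComplexShape ι}
    (E : HomologicalComplex A.X.left.Modules c) (hE : ∀ i, IsAffineLocalizing (E.X i)) :
    Nonempty (((Scheme.Modules.pullback (Hom.toSchemeHom g)).mapHomologicalComplex c).obj
        (((Scheme.Modules.pushforward (Hom.toSchemeHom g)).mapHomologicalComplex c).obj E) ≅
      ∐ fun x : Hom.kerPoints (specOver ℂ ℂ) g =>
        ((Scheme.Modules.pullback (A.translation x.1).left).mapHomologicalComplex c).obj E) := by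
  haveI := hg.2
  haveI : Finite (Hom.kerPoints (specOver ℂ ℂ) g) := finite_kerPoints_of_isFinite g ℂ
  exact nonempty_pullback_pushforward_complex_iso_sigma (Hom.toSchemeHom g) (kerTranslation g) (kerTranslation_comp g) E
    fun i => isIso_toPi_kerTranslation g hg _ (hE i)

/-- **`g^*(g_*E•) ≅ ∐_{x ∈ Ker g(ℂ)} t_x^*E•` for a cochain complex of vector bundles** (e.g. a bounded complex of vector bundles,
`IsBoundedVBComplex.isFiniteLocallyFree`): the form consumed on the Hodge road, where `g^*`, `g_*`, `t_x^*` on complexes are the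
road's `endoPushforwardComplex` ∕ `translationPullbackComplex` (Mathlib's termwise functors).
[cite: MumfordAV1970, §7 Thm. 4 (p. 72) and §12 Thm. 1 (p. 111)] [cite: Mukai1978, §3 Prop. 3.12 (p. 249)] -/
theorem nonempty_pullback_pushforward_complex_iso_sigma_of_isFiniteLocallyFree (hg : IsIsogeny g)
    (E : CochainComplex A.X.left.Modules ℤ) (hE : ∀ i, IsFiniteLocallyFree (E.X i)) :
    Nonempty (((Scheme.Modules.pullback (Hom.toSchemeHom g)).mapHomologicalComplex (ComplexShape.up ℤ)).obj
        (((Scheme.Modules.pushforward (Hom.toSchemeHom g)).mapHomologicalComplex (ComplexShape.up ℤ)).obj E) ≅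
      ∐ fun x : Hom.kerPoints (specOver ℂ ℂ) g =>
        ((Scheme.Modules.pullback (A.translation x.1).left).mapHomologicalComplex (ComplexShape.up ℤ)).obj E) :=
  nonempty_pullback_pushforward_complex_iso_sigma_kerTranslation g hg E fun i => by
    haveI := (hE i).isVectorBundle.1
    exact IsAffineLocalizing.of_isQuasicoherent _

end AbelianVariety

end Literature.AlgebraicGeometry.Motives

end
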